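import Summits.Ventures.CertifiedManyBodySolver.Rows.HalfFilledTLTorusSpin
import Summits.Ventures.CertifiedManyBodySolver.Rows.HalfFilledTLDerived

/-!
# M2 rows, part 6: finite even tori — the staggered structure-factor cells `T{L}_S` / `T{L}_ms2`

HONEST FRAMING (speedrun cell `mbsolver`, M2): first certified bounds; not a superconductivity
verdict; every number certified or labelled float.  This file contains NO numbers: it supplies the
typed homes of the finite-torus cells `T{L}_S` (`S(π,π)` per site) and `T{L}_ms2` (`m_s²(L) = S(π,π)/L²`)
of the M2 table (`HOME/m2/M2-TABLE.md`) and the by-name bridges filling them; a cell is filled only by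
a certificate-backed term of the named type.  Companion of parts 4–5 (`Rows/HalfFilledTLTorus.lean`,
`Rows/HalfFilledTLTorusSpin.lean`); a torus number is never a thermodynamic-limit number here (the only
TL statement about `S(π,π)/N` in M2 is the one-sided ceiling `StagMagSqTLCeilingRow` of part 1; a TL floor
would be Néel long-range order, which is open).

§1 one-sided rows `StagMagSq{Lower,Upper}Row` / `TorusDocc{Lower,Upper}Row` (splitting part 1's
`StagMagSqRow` / `TorusDoccRow`), `iff`s, outward roundings `.mono`.  §2 the `S(π,π)`-per-site row
`TorusStagSFRow L U lo hi : lo ≤ S_s(π,π; ψ) ≤ hi` over m3-7's `Observables.spinStructureFactor L (piIndex L)`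
and `TorusStagSFRow.iff_stagMagSqRow : … ↔ StagMagSqRow L U (lo/L²) (hi/L²)` (even `L`, part 2).
§3 `evenSublattice_eq_filter_even` (`A = {x : x₁ + x₂ even}`, the substrate's spelling, so that its
`stagStructureFour = stagSpinStructure (evenSublattice 4)` is `rw; rfl` at the use site).  §4 SECTOR-node
bridges (shape of part 5): a node "`E₀(N) ≤ u` ⟹ ∀ unit `N`-particle `ψ`, `Hψ = E₀ψ` ⟹ `q ≤ Re⟨ψ, (±1 • X) ψ⟩`"
with `X = 𝓢_A` up to a `rw` (hypothesis `hX`), the energy ceiling `u` it was issued for and an outward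
rounding IS the cell's floor / ceiling: `StagMagSqLowerRow.of_sectorNode`, `StagMagSqUpperRow.of_sectorNodeNeg`
(docc: part 5's `TorusDoccRow.of_sectorNodes`, then `torusDoccRow_iff`).  §5 SOLVER-FREE one-sided
edges on an even torus, `U > 0` (Lieb: THE half-filled ground state, a singlet; Shen–Qiu–Tian sign rule):
floor A `m_s² ≥ (3/2)(1 − 2d)/L²` from a docc CEILING (`StagMagSqLowerRow.of_torusDoccUpperRow`); the
Casimir ceiling `m_s² ≤ (1/4 + 1/L²)(1 − 2d)` from a docc FLOOR (`StagMagSqUpperRow.of_torusDoccLowerRow`);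
floor B, new here, `m_s² ≥ −8 C_nn/L²` from a nearest-neighbour spin CEILING (`L ≥ 3`;
`stagMagSq_ge_neg_eight_mul_torusSpinNN`, `StagMagSqLowerRow.of_torusSpinNNUpperRow`).  Floor B is §0's
graph lemma `neg_two_mul_bondSpinSum_le_stagSpinStructure` (connected balanced bipartite graph, THE
half-filled ground state): in sublattice blocks `Re⟨𝓢_A⟩ = AA + BB − AB − BA`, the singlet sum rule
`(Σ_{x,y} 𝐒_x·𝐒_y) ψ = S²ψ = 0` gives `AA + BB = −(AB + BA)`, so `Re⟨𝓢_A⟩ = −2(AB + BA)`; cross pairs have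
`Re⟨𝐒_x·𝐒_y⟩ ≤ 0` and bonds join opposite sublattices only, so `AB + BA ≤ Re⟨bond sum⟩ = 4L² C_nn`
(part 5, `expect_bondSpinSum_eq`).

References: Lieb, PRL 62 (1989) 1201, Theorem 2; Shen–Qiu–Tian, PRL 72 (1994) 1280, Theorem and
eqs. (7)–(9); Tian, J. Stat. Phys. 116 (2004) 629, §3; Tasaki (2020) §10.1, App. A.3; Hirsch, PRB 31
(1985) 4403, eq. (4.7), §III; Wang et al., PRX 14 (2024) 031006 §III (sector certificates).
-/

noncomputable section

namespace Summit.Ventures.CertifiedManyBodySolver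

open Literature.MathematicalPhysics.QuantumLattice
open Matrix HubbardWave0 Literature.Probability.LatticeModels FermionSpinMoment ThermodynamicLimit
  Filter Topology
open Literature.MathematicalPhysics.QuantumLattice.FermionTorus (ofTorusSite toTorusSite)
open scoped ComplexOrder BigOperators

namespace M2

/-! ## §0 The sign-rule floor of the staggered structure by the bond sum (any balanced bipartite graph) -/

section Generic

variable {Λ : Type*} [LinearOrder Λ] [Fintype Λ]

omit [LinearOrder Λ] in
/-- `Re⟨ψ, (Σ_{x∈s} Σ_{y∈t} X_{xy}) ψ⟩ = Σ_{x∈s} Σ_{y∈t} Re⟨ψ, X_{xy} ψ⟩`. [folklore] -/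
theorem re_expect_sum_sum {α β : Type*} (s : Finset α) (t : Finset β)
    (X : α → β → Matrix (Finset (Orb Λ)) (Finset (Orb Λ)) ℂ) (ψ : Fock (Orb Λ)) :
    (expect (∑ x ∈ s, ∑ y ∈ t, X x y) ψ).re = ∑ x ∈ s, ∑ y ∈ t, (expect (X x y) ψ).re := by
  rw [expect_sum, Complex.re_sum]
  exact Finset.sum_congr rfl fun x _ => by rw [expect_sum, Complex.re_sum]

/-- Block decomposition of a double sum over `Λ × Λ` along a bipartition `Λ = A ⊔ Aᶜ`:
`Σ_{x,y} g = (AA + AAᶜ) + (AᶜA + AᶜAᶜ)`. [folklore] -/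
theorem sum_sum_eq_blocks (A : Finset Λ) (g : Λ → Λ → ℝ) :
    ∑ x, ∑ y, g x y =
      (∑ x ∈ A, ∑ y ∈ A, g x y + ∑ x ∈ A, ∑ y ∈ Aᶜ, g x y) +
        (∑ x ∈ Aᶜ, ∑ y ∈ A, g x y + ∑ x ∈ Aᶜ, ∑ y ∈ Aᶜ, g x y) := by
  rw [← Finset.sum_add_sum_compl A]
  congr 1
  · rw [← Finset.sum_add_distrib]
    exact Finset.sum_congr rfl fun x _ => (Finset.sum_add_sum_compl A _).symm
  · rw [← Finset.sum_add_distrib]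
    exact Finset.sum_congr rfl fun x _ => (Finset.sum_add_sum_compl A _).symm

variable {G : SimpleGraph Λ} [DecidableRel G.Adj]

/-- **Singlet sum rule + sign rule: the bond sum floors the staggered structure.**  On a connected
bipartite graph with colour class `A`, `|Aᶜ| = |A|`, `t ≠ 0`, `U > 0`, for every half-filled ground state
`ψ` (`N = |Λ|`, `Hψ = E₀ψ`): `−2 Re⟨ψ, (Σ_x Σ_{y ∼ x} 𝐒_x·𝐒_y) ψ⟩ ≤ Re⟨ψ, 𝓢_A ψ⟩`.  Proof: in sublattice
blocks `Re⟨𝓢_A⟩ = AA + BB − AB − BA` while `AA + AB + BA + BB = Re⟨ψ, S² ψ⟩ = 0` (Lieb: the ground state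
is a singlet), so `Re⟨𝓢_A⟩ = −2(AB + BA)`; bonds join opposite sublattices only, and every cross pair has
`Re⟨𝐒_x·𝐒_y⟩ ≤ 0` (Shen–Qiu–Tian), so `AB + BA ≤ Re⟨bond sum⟩`.
[cite: ShenQiuTian1994, Theorem and eqs. (7)–(9)] [cite: LiebPRL1989, Theorem 2] [cite: Tian2004, §3] -/
theorem neg_two_mul_bondSpinSum_le_stagSpinStructure (hG : G.Connected) (A : Finset Λ)
    (hA : ∀ x y : Λ, G.Adj x y → (x ∈ A ↔ y ∉ A)) (hcard : Aᶜ.card = A.card)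
    {t U : ℝ} (ht : t ≠ 0) (hU : 0 < U) {ψ : Fock (Orb Λ)} (hN : IsNParticle (Fintype.card Λ) ψ)
    (hHψ : hamiltonian G t U *ᵥ ψ = ((groundEnergyAt G t U (Fintype.card Λ) : ℝ) : ℂ) • ψ) :
    -2 * (expect (∑ x, ∑ y, if G.Adj x y then fermionSpinDot x y else 0) ψ).re ≤
      (expect (stagSpinStructure A) ψ).re := by
  classical
  set f : Λ → Λ → ℝ := fun x y => (expect (fermionSpinDot x y) ψ).re with hf
  -- (1) the singlet sum rule: `Σ_{x,y} Re⟨𝐒_x·𝐒_y⟩ = Re⟨S²⟩ = 0`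
  have hmem : ψ ∈ (hamiltonian G t U).sectorGroundSpace
      (nParticleSubmodule (ι := Orb Λ) (Fintype.card Λ)) :=
    (LiebHalfFilled.mem_groundSector_iff G t U _ ψ).2 ⟨hN, hHψ⟩
  have hS := (LiebHalfFilled.finrank_groundSector_eq_one hG A hA hcard ht hU).2 ψ hmem
  have htot : ∑ x, ∑ y, f x y = 0 := by
    have h0 : expect (∑ x, ∑ y, fermionSpinDot x y) ψ = 0 := by
      rw [expect, sum_sum_fermionSpinDot, hS, dotProduct_zero]
    have h1 := congrArg Complex.re h0
    rw [re_expect_sum_sum] at h1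
    simpa using h1
  rw [sum_sum_eq_blocks A] at htot
  -- (2) the staggered structure in blocks: `AA − AB − BA + BB`
  have hstag : (expect (stagSpinStructure A) ψ).re =
      (∑ x ∈ A, ∑ y ∈ A, f x y + -∑ x ∈ A, ∑ y ∈ Aᶜ, f x y) +
        (-∑ x ∈ Aᶜ, ∑ y ∈ A, f x y + ∑ x ∈ Aᶜ, ∑ y ∈ Aᶜ, f x y) := by
    unfold stagSpinStructure
    rw [re_expect_sum_sum, sum_sum_eq_blocks A]
    simp only [expect_smul]
    congr 2
    · exact Finset.sum_congr rfl fun x hx => Finset.sum_congr rfl fun y hy => by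
        rw [stagSign_mul_of_mem hx hy, one_mul]
    · rw [← Finset.sum_neg_distrib]
      refine Finset.sum_congr rfl fun x hx => ?_
      rw [← Finset.sum_neg_distrib]
      refine Finset.sum_congr rfl fun y hy => ?_
      rw [stagSign_of_mem hx, stagSign_of_mem_compl hy, one_mul, neg_one_mul, Complex.neg_re]
    · rw [← Finset.sum_neg_distrib]
      refine Finset.sum_congr rfl fun x hx => ?_
      rw [← Finset.sum_neg_distrib]
      refine Finset.sum_congr rfl fun y hy => ?_
      rw [stagSign_of_mem_compl hx, stagSign_of_mem hy, mul_one, neg_one_mul, Complex.neg_re]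
    · exact Finset.sum_congr rfl fun x hx => Finset.sum_congr rfl fun y hy => by
        rw [stagSign_mul_of_mem_compl hx hy, one_mul]
  -- (3) the bond sum in blocks: same-sublattice blocks vanish, cross blocks dominate `AB`, `BA`
  have hbond : (expect (∑ x, ∑ y, if G.Adj x y then fermionSpinDot x y else 0) ψ).re =
      ∑ x, ∑ y, if G.Adj x y then f x y else 0 := by
    rw [re_expect_sum_sum]
    refine Finset.sum_congr rfl fun x _ => Finset.sum_congr rfl fun y _ => ?_
    split_ifs
    · rfl
    · simp [expect]
  rw [sum_sum_eq_blocks A] at hbond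
  have hAA : ∑ x ∈ A, ∑ y ∈ A, (if G.Adj x y then f x y else 0) = 0 :=
    Finset.sum_eq_zero fun x hx => Finset.sum_eq_zero fun y hy => by
      rw [if_neg fun h => (hA x y h).1 hx hy]
  have hBB : ∑ x ∈ Aᶜ, ∑ y ∈ Aᶜ, (if G.Adj x y then f x y else 0) = 0 :=
    Finset.sum_eq_zero fun x hx => Finset.sum_eq_zero fun y hy => by
      rw [if_neg fun h => Finset.mem_compl.1 hx ((hA x y h).2 (Finset.mem_compl.1 hy))]
  have hAB : ∑ x ∈ A, ∑ y ∈ Aᶜ, f x y ≤ ∑ x ∈ A, ∑ y ∈ Aᶜ, (if G.Adj x y then f x y else 0) :=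
    Finset.sum_le_sum fun x hx => Finset.sum_le_sum fun y hy => by
      split_ifs
      · exact le_rfl
      · exact re_expect_fermionSpinDot_nonpos_of_mem_of_mem_compl hG A hA hcard ht hU hN hHψ hx hy
  have hBA : ∑ x ∈ Aᶜ, ∑ y ∈ A, f x y ≤ ∑ x ∈ Aᶜ, ∑ y ∈ A, (if G.Adj x y then f x y else 0) :=
    Finset.sum_le_sum fun x hx => Finset.sum_le_sum fun y hy => by
      split_ifs
      · exact le_rfl
      · exact re_expect_fermionSpinDot_nonpos_of_opposite_sublattice hG A hA hcard ht hU hN hHψ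
          (by rw [stagSign_of_mem_compl hx, stagSign_of_mem hy]; norm_num)
  rw [hstag, hbond, hAA, hBB]
  linarith

end Generic

section Torus

variable {L : ℕ} [NeZero L]

/-! ## §1 One-sided finite-torus rows and their outward roundings -/

/-- One-sided: the floor `lo ≤ m_s²(L; ψ)` on normalised `L²`-particle ground states (cell `T{L}_ms2.lo`;
`× L²` it is `T{L}_S.lo`). [cite: LiebPRL1989, Theorem 2] -/
def StagMagSqLowerRow (L : ℕ) [NeZero L] (U : ℝ) (lo : ℚ) : Prop :=
  ∀ ψ : Fock (Orb (FermionTorus 2 L)),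
    IsGroundState (hamiltonian (fermionTorusGraph 2 L) 1 U) (L ^ 2) ψ → star ψ ⬝ᵥ ψ = 1 →
      ((lo : ℚ) : ℝ) ≤ stagMagSq L ψ

/-- One-sided: the ceiling `m_s²(L; ψ) ≤ hi` on normalised `L²`-particle ground states (cell
`T{L}_ms2.hi`). [cite: LiebPRL1989, Theorem 2] -/
def StagMagSqUpperRow (L : ℕ) [NeZero L] (U : ℝ) (hi : ℚ) : Prop :=
  ∀ ψ : Fock (Orb (FermionTorus 2 L)),
    IsGroundState (hamiltonian (fermionTorusGraph 2 L) 1 U) (L ^ 2) ψ → star ψ ⬝ᵥ ψ = 1 →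
      stagMagSq L ψ ≤ ((hi : ℚ) : ℝ)

/-- Floor and ceiling make part 1's two-sided row `StagMagSqRow`. [cite: LiebPRL1989, Theorem 2] -/
theorem StagMagSqRow.of_lower_upper {U : ℝ} {lo hi : ℚ} (hlo : StagMagSqLowerRow L U lo)
    (hhi : StagMagSqUpperRow L U hi) : StagMagSqRow L U lo hi :=
  fun ψ hψ h1 => ⟨hlo ψ hψ h1, hhi ψ hψ h1⟩

/-- `StagMagSqRow = StagMagSqLowerRow ∧ StagMagSqUpperRow`. [cite: LiebPRL1989, Theorem 2] -/
theorem stagMagSqRow_iff {U : ℝ} {lo hi : ℚ} :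
    StagMagSqRow L U lo hi ↔ StagMagSqLowerRow L U lo ∧ StagMagSqUpperRow L U hi :=
  ⟨fun h => ⟨fun ψ hψ h1 => (h ψ hψ h1).1, fun ψ hψ h1 => (h ψ hψ h1).2⟩,
    fun h => StagMagSqRow.of_lower_upper h.1 h.2⟩

/-- Outward rounding of an `m_s²` floor (side goal `lo ≤ q` by `norm_num`). [folklore] -/
theorem StagMagSqLowerRow.mono {U : ℝ} {q lo : ℚ} (h : StagMagSqLowerRow L U q) (hlo : lo ≤ q) :
    StagMagSqLowerRow L U lo :=
  fun ψ hψ h1 => ((Rat.cast_le (K := ℝ)).2 hlo).trans (h ψ hψ h1)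

/-- Outward rounding of an `m_s²` ceiling (side goal `q ≤ hi` by `norm_num`). [folklore] -/
theorem StagMagSqUpperRow.mono {U : ℝ} {q hi : ℚ} (h : StagMagSqUpperRow L U q) (hhi : q ≤ hi) :
    StagMagSqUpperRow L U hi :=
  fun ψ hψ h1 => (h ψ hψ h1).trans ((Rat.cast_le (K := ℝ)).2 hhi)

/-- One-sided: the docc-density floor `lo ≤ d_L(ψ)` on normalised `L²`-particle ground states (cell
`T{L}_D.lo`). [cite: KomaTasaki1994, §1] -/
def TorusDoccLowerRow (L : ℕ) [NeZero L] (U : ℝ) (lo : ℚ) : Prop :=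
  ∀ ψ : Fock (Orb (FermionTorus 2 L)),
    IsGroundState (hamiltonian (fermionTorusGraph 2 L) 1 U) (L ^ 2) ψ → star ψ ⬝ᵥ ψ = 1 →
      ((lo : ℚ) : ℝ) ≤ doccDensity L ψ

/-- One-sided: the docc-density ceiling `d_L(ψ) ≤ hi` on normalised `L²`-particle ground states (cell
`T{L}_D.hi`). [cite: KomaTasaki1994, §1] -/
def TorusDoccUpperRow (L : ℕ) [NeZero L] (U : ℝ) (hi : ℚ) : Prop :=
  ∀ ψ : Fock (Orb (FermionTorus 2 L)),
    IsGroundState (hamiltonian (fermionTorusGraph 2 L) 1 U) (L ^ 2) ψ → star ψ ⬝ᵥ ψ = 1 →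
      doccDensity L ψ ≤ ((hi : ℚ) : ℝ)

/-- Floor and ceiling make part 1's two-sided row `TorusDoccRow`. [cite: KomaTasaki1994, §1] -/
theorem TorusDoccRow.of_lower_upper {U : ℝ} {lo hi : ℚ} (hlo : TorusDoccLowerRow L U lo)
    (hhi : TorusDoccUpperRow L U hi) : TorusDoccRow L U lo hi :=
  fun ψ hψ h1 => ⟨hlo ψ hψ h1, hhi ψ hψ h1⟩

/-- `TorusDoccRow = TorusDoccLowerRow ∧ TorusDoccUpperRow`. [cite: KomaTasaki1994, §1] -/
theorem torusDoccRow_iff {U : ℝ} {lo hi : ℚ} :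
    TorusDoccRow L U lo hi ↔ TorusDoccLowerRow L U lo ∧ TorusDoccUpperRow L U hi :=
  ⟨fun h => ⟨fun ψ hψ h1 => (h ψ hψ h1).1, fun ψ hψ h1 => (h ψ hψ h1).2⟩,
    fun h => TorusDoccRow.of_lower_upper h.1 h.2⟩

/-- Outward rounding of a docc floor. [folklore] -/
theorem TorusDoccLowerRow.mono {U : ℝ} {q lo : ℚ} (h : TorusDoccLowerRow L U q) (hlo : lo ≤ q) :
    TorusDoccLowerRow L U lo :=
  fun ψ hψ h1 => ((Rat.cast_le (K := ℝ)).2 hlo).trans (h ψ hψ h1)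

/-- Outward rounding of a docc ceiling. [folklore] -/
theorem TorusDoccUpperRow.mono {U : ℝ} {q hi : ℚ} (h : TorusDoccUpperRow L U q) (hhi : q ≤ hi) :
    TorusDoccUpperRow L U hi :=
  fun ψ hψ h1 => (h ψ hψ h1).trans ((Rat.cast_le (K := ℝ)).2 hhi)

/-! ## §2 The `S(π,π)`-per-site row `T{L}_S` and its exchange rate with `T{L}_ms2` -/

/-- **Finite-torus staggered structure-factor row** `T{L}_S`: `lo ≤ S_s(π,π; ψ) ≤ hi` for every
normalised `L²`-particle ground state, `S_s(q; ψ) = L⁻² Re⟨ψ, 𝓢_s(q) ψ⟩` m3-7's FULL-`𝐒·𝐒` structure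
factor (`Observables.spinStructureFactor`) at `q = (π,π)` (`piIndex`). [cite: HirschPRB1985, eq. (4.7)] -/
def TorusStagSFRow (L : ℕ) [NeZero L] (U : ℝ) (lo hi : ℚ) : Prop :=
  ∀ ψ : Fock (Orb (FermionTorus 2 L)),
    IsGroundState (hamiltonian (fermionTorusGraph 2 L) 1 U) (L ^ 2) ψ → star ψ ⬝ᵥ ψ = 1 →
      ((lo : ℚ) : ℝ) ≤ Observables.spinStructureFactor L (piIndex L) ψ ∧
        Observables.spinStructureFactor L (piIndex L) ψ ≤ ((hi : ℚ) : ℝ)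

/-- **`T{L}_S = L² · T{L}_ms2`** (even `L`): `TorusStagSFRow L U lo hi ↔ StagMagSqRow L U (lo/L²) (hi/L²)`,
by `S_s(π,π; ψ) = L² m_s²(L; ψ)` (`spinStructureFactor_piIndex`, part 2). [cite: HirschPRB1985, eq. (4.7)] -/
theorem TorusStagSFRow.iff_stagMagSqRow (hL : Even L) {U : ℝ} {lo hi : ℚ} :
    TorusStagSFRow L U lo hi ↔ StagMagSqRow L U (lo / (L : ℚ) ^ 2) (hi / (L : ℚ) ^ 2) := by
  have hL0 : (0 : ℝ) < (L : ℝ) ^ 2 := by have := NeZero.pos L; positivity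
  unfold TorusStagSFRow StagMagSqRow
  refine forall₃_congr fun ψ _ _ => ?_
  rw [spinStructureFactor_piIndex L hL ψ]
  push_cast
  rw [div_le_iff₀ hL0, le_div_iff₀ hL0, mul_comm ((L : ℝ) ^ 2)]

/-! ## §3 The even sublattice spelled by coordinate parity -/

/-- `A = {z : (−1)^{z₁+z₂} = 1} = {z : z₁ + z₂ even}` — the spelling of the substrate's `4 × 4` staggered
operator (`stagStructureFour = stagSpinStructure (univ.filter fun x => Even (x₀ + x₁))`), so that
`stagStructureFour = stagSpinStructure (evenSublattice 4)` is `by rw [evenSublattice_eq_filter_even]; rfl`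
at the use site. [cite: LiebPRL1989, Theorem 2] -/
theorem evenSublattice_eq_filter_even :
    evenSublattice L =
      Finset.univ.filter fun x : FermionTorus 2 L => Even ((ofLex x 0).val + (ofLex x 1).val) := by
  unfold evenSublattice
  refine Finset.filter_congr fun z _ => ?_
  rw [torusStagger_apply, Fin.sum_univ_two]
  rcases Nat.even_or_odd ((ofLex z 0).val + (ofLex z 1).val) with h | h
  · exact ⟨fun _ => h, fun _ => h.neg_one_pow⟩
  · exact ⟨fun h1 => absurd (h1.symm.trans h.neg_one_pow) (by decide),
      fun h' => absurd h' (Nat.not_even_iff_odd.2 h)⟩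

/-! ## §4 Sector-node bridges (`X = 𝓢_A`; any `L`, `U`) -/

/-- **Sector node ⟹ `m_s²` floor.**  A node "`E₀(N) ≤ u` ⟹ ∀ unit `N`-particle `ψ` with `Hψ = E₀ψ`,
`q ≤ Re⟨ψ, (1 • X) ψ⟩`" for `X = 𝓢_A` (`hX`; `N = L²` a numeral, `hN`), the energy ceiling `u` it was
issued for, and the outward rounding `lo · L⁴ ≤ q` give `StagMagSqLowerRow L U lo`.
[cite: WangEtAl2024, §III] [cite: LiebPRL1989, Theorem 2] -/
theorem StagMagSqLowerRow.of_sectorNode {U : ℝ} {N : ℕ} (hN : L ^ 2 = N)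
    {X : Matrix (Finset (Orb (FermionTorus 2 L))) (Finset (Orb (FermionTorus 2 L))) ℂ}
    (hX : X = stagSpinStructure (evenSublattice L)) {u q lo : ℚ} (hE : TorusEnergyUpperRow L U u)
    (h : groundEnergyAt (fermionTorusGraph 2 L) 1 U N ≤ ((u : ℚ) : ℝ) →
      ∀ ψ : Fock (Orb (FermionTorus 2 L)), IsNParticle N ψ → star ψ ⬝ᵥ ψ = 1 →
        hamiltonian (fermionTorusGraph 2 L) 1 U *ᵥ ψ =
          ((groundEnergyAt (fermionTorusGraph 2 L) 1 U N : ℝ) : ℂ) • ψ →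
        ((q : ℚ) : ℝ) ≤ (star ψ ⬝ᵥ ((((1 : ℚ) : ℂ)) • X) *ᵥ ψ).re)
    (hlo : lo * (L : ℚ) ^ 4 ≤ q) : StagMagSqLowerRow L U lo := by
  subst hN hX
  intro ψ hψ h1
  have hq := h hE ψ hψ.1 h1 hψ.2.2
  rw [← expect, expect_smul, Rat.cast_one, one_mul] at hq
  have hlo' := (Rat.cast_le (K := ℝ)).2 hlo
  push_cast at hlo'
  have hL0 : (0 : ℝ) < (L : ℝ) ^ 4 := by have := NeZero.pos L; positivity
  unfold stagMagSq
  rw [le_div_iff₀ hL0]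
  linarith

/-- **Sector node ⟹ `m_s²` ceiling** (`λ = −1`: `q ≤ Re⟨ψ, (−1 • 𝓢_A) ψ⟩`, outward rounding
`−q ≤ hi · L⁴`). [cite: WangEtAl2024, §III] [cite: LiebPRL1989, Theorem 2] -/
theorem StagMagSqUpperRow.of_sectorNodeNeg {U : ℝ} {N : ℕ} (hN : L ^ 2 = N)
    {X : Matrix (Finset (Orb (FermionTorus 2 L))) (Finset (Orb (FermionTorus 2 L))) ℂ}
    (hX : X = stagSpinStructure (evenSublattice L)) {u q hi : ℚ} (hE : TorusEnergyUpperRow L U u)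
    (h : groundEnergyAt (fermionTorusGraph 2 L) 1 U N ≤ ((u : ℚ) : ℝ) →
      ∀ ψ : Fock (Orb (FermionTorus 2 L)), IsNParticle N ψ → star ψ ⬝ᵥ ψ = 1 →
        hamiltonian (fermionTorusGraph 2 L) 1 U *ᵥ ψ =
          ((groundEnergyAt (fermionTorusGraph 2 L) 1 U N : ℝ) : ℂ) • ψ →
        ((q : ℚ) : ℝ) ≤ (star ψ ⬝ᵥ ((((-1 : ℚ) : ℂ)) • X) *ᵥ ψ).re)
    (hhi : -q ≤ hi * (L : ℚ) ^ 4) : StagMagSqUpperRow L U hi := by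
  subst hN hX
  intro ψ hψ h1
  have hq := h hE ψ hψ.1 h1 hψ.2.2
  rw [← expect, expect_smul] at hq
  have hre : ((((-1 : ℚ) : ℂ)) * expect (stagSpinStructure (evenSublattice L)) ψ).re =
      -(expect (stagSpinStructure (evenSublattice L)) ψ).re := by
    simp
  rw [hre] at hq
  have hhi' := (Rat.cast_le (K := ℝ)).2 hhi
  push_cast at hhi'
  have hL0 : (0 : ℝ) < (L : ℝ) ^ 4 := by have := NeZero.pos L; positivity
  unfold stagMagSq
  rw [div_le_iff₀ hL0]
  linarith

/-! ## §5 Solver-free one-sided edges on an even torus (`U > 0`) -/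

/-- **Floor A — docc CEILING ⟹ `m_s²` floor** `(3/2)(1 − 2 dhi)/L²` (the Néel-sum floor `stagMagSq_ge`
of part 1, one-sided). [cite: ShenQiuTian1994, Theorem and eqs. (7)–(9)] [cite: LiebPRL1989, Theorem 2] -/
theorem StagMagSqLowerRow.of_torusDoccUpperRow {U : ℝ} (hU : 0 < U) (hL : Even L) {dhi : ℚ}
    (h : TorusDoccUpperRow L U dhi) : StagMagSqLowerRow L U (3 / 2 * (1 - 2 * dhi) / (L : ℚ) ^ 2) := by
  intro ψ hψ h1
  have hd := h ψ hψ h1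
  push_cast
  refine le_trans ?_ (stagMagSq_ge hU hL hψ h1)
  gcongr

/-- **Casimir ceiling — docc FLOOR ⟹ `m_s²` ceiling** `(1/4 + 1/L²)(1 − 2 dlo)` (part 1's `stagMagSq_le`,
one-sided; no hypothesis on `U`). [cite: Tasaki2020, App. A.3] [cite: LiebPRL1989, Theorem 2] -/
theorem StagMagSqUpperRow.of_torusDoccLowerRow {U : ℝ} (hL : Even L) {dlo : ℚ}
    (h : TorusDoccLowerRow L U dlo) : StagMagSqUpperRow L U ((1 / 4 + 1 / (L : ℚ) ^ 2) * (1 - 2 * dlo)) := by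
  intro ψ hψ h1
  have hd := h ψ hψ h1
  push_cast
  refine (stagMagSq_le hL hψ.1 h1).trans ?_
  gcongr

/-- **Floor B — `m_s²(L; ψ) ≥ −8 C_nn(L; ψ)/L²`** for THE half-filled ground state of an even `L × L`
torus, `L ≥ 3`, `U > 0` (`C_nn = torusSpinNN`, part 5): `neg_two_mul_bondSpinSum_le_stagSpinStructure`
with the torus bond sum `= 4 L² C_nn` (`expect_bondSpinSum_eq`).
[cite: ShenQiuTian1994, Theorem and eqs. (7)–(9)] [cite: LiebPRL1989, Theorem 2] [cite: HirschPRB1985, §III] -/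
theorem stagMagSq_ge_neg_eight_mul_torusSpinNN (hL3 : 3 ≤ L) (hL : Even L) {U : ℝ} (hU : 0 < U)
    {ψ : Fock (Orb (FermionTorus 2 L))}
    (hψ : IsGroundState (hamiltonian (fermionTorusGraph 2 L) 1 U) (L ^ 2) ψ) :
    -8 * torusSpinNN L ψ / (L : ℝ) ^ 2 ≤ stagMagSq L ψ := by
  obtain ⟨hG, hA, h2, -⟩ := LiebHalfFilled.hubbardTorus_lieb_hypotheses (L := L) hL
  have hcard := LiebHalfFilled.compl_card_eq_card_of_two_mul h2
  have hN := hψ.1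
  have hH := hψ.2.2
  rw [← LangerMattis.card_fermionTorus_eq (d := 2) (L := L)] at hN hH
  have h := neg_two_mul_bondSpinSum_le_stagSpinStructure hG _ hA hcard one_ne_zero hU hN hH
  rw [expect_bondSpinSum_eq hL3 hL hU hψ] at h
  have hre : (4 * expect (Observables.spinCorrSum L (Pi.single 0 1)) ψ).re =
      4 * (expect (Observables.spinCorrSum L (Pi.single 0 1)) ψ).re := by
    simp [Complex.mul_re]
  rw [hre] at h
  have hL1 : (L : ℝ) ≠ 0 := by exact_mod_cast NeZero.ne L
  have key : -8 * ((expect (Observables.spinCorrSum L (Pi.single 0 1)) ψ).re / (L : ℝ) ^ 2) / (L : ℝ) ^ 2 =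
      -2 * (4 * (expect (Observables.spinCorrSum L (Pi.single 0 1)) ψ).re) / (L : ℝ) ^ 4 := by
    field_simp
    ring
  unfold stagMagSq evenSublattice
  rw [torusSpinNN_eq, key]
  exact div_le_div_of_nonneg_right h (by positivity)

/-- **Floor B as a row edge — nearest-neighbour spin CEILING ⟹ `m_s²` floor `−8 chi / L²`** (even `L ≥ 3`,
`U > 0`; `chi` = cell `T{L}_C1.hi`, part 5's `TorusSpinNNUpperRow`).
[cite: ShenQiuTian1994, Theorem and eqs. (7)–(9)] [cite: LiebPRL1989, Theorem 2] -/
theorem StagMagSqLowerRow.of_torusSpinNNUpperRow (hL3 : 3 ≤ L) (hL : Even L) {U : ℝ} (hU : 0 < U)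
    {chi : ℚ} (h : TorusSpinNNUpperRow L U chi) : StagMagSqLowerRow L U (-8 * chi / (L : ℚ) ^ 2) := by
  intro ψ hψ h1
  have hc := h ψ hψ h1
  have hL0 : (0 : ℝ) < (L : ℝ) ^ 2 := by have := NeZero.pos L; positivity
  push_cast
  refine le_trans ?_ (stagMagSq_ge_neg_eight_mul_torusSpinNN hL3 hL hU hψ)
  exact div_le_div_of_nonneg_right (by linarith) hL0.le

end Torus

end M2

end Summit.Ventures.CertifiedManyBodySolver

end
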